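import Summits.ABC.StewartYu.ArchG3HalfPoint
import Literature.NumberTheory.Transcendental.CijsouwWaldschmidt1977Liouville
import HarnessLib

/-!
# Cell abc-stewartyu, rung A1.L (crux r2 `ArchCoreRat`), WP-L.A parcel P-A6 (Kummer half-step), part 1: the class functions at the HALF
# POINTS `s/2` — values in `ℚ(√α₁, …, √αₙ)` on the square-root monomials `∏_{j∈T} √αⱼ`

`Summits/ABC/StewartYu/ArchG3HalfValues.lean` — cell `abc-stewartyu` (HOME `run/shared/lean/pub/abc-stewartyu/`; TRANCHE PLAN v1.2 §4′ P-A6;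
seat lp-1 g8).  Definitions (`halfExp`, `oddSet`, `qEhZ`, `rHalf`, `halfClassVec` — place-free rational bookkeeping) and theorems on
`ArchG3Setup`; no named fact.  Archimedean twin of `PadicG3HalfValues` (seat p2-g4) and of the tree's `CW77.Setup.cexp_ψ_half` /
`Φ_half` (Cijsouw–Waldschmidt §4, p. 189; Waldschmidt 1980 Lemma 3.7), for the generic class family `(R, v)` with INTEGER (signed)
exponents: at a half point `z = s/2`, `s ∈ ℤ`,

  `exp(Lsum w · s/2) = ∏ⱼ (√αⱼ)^{wⱼ s} = qEhZ w s · ∏_{j ∈ oddSet w s} √αⱼ`,  `qEhZ w s = ∏ⱼ αⱼ^{⌊wⱼ s/2⌋} ∈ ℚ`,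

so that `φ_τ(s/2) = Σ_T C_T · ∏_{j∈T} √αⱼ = ev α C` (`CW77.ev`) with the RATIONAL class sums
`C_T = halfClassVec R v B pv τ s T = Σ_{i ∈ B, oddSet(vᵢ) s = T} pᵢ · (Hasse_{t₀}Rᵢ)(s/2) · zγpow · qEhZ(vᵢ) s` (Nesterenko §4.3: the values at
`y + ½` lie in `ℚ(√α₁,…,√αₙ)`, (4.42)–(4.45)).  The separation (part 2: smallness of `φ_τ(s/2)` + Waldschmidt's sharp Liouville inequality
`Waldschmidt1980.abs_ev_ge_sharp` under the independence of the square classes ⇒ every `C_T = 0`) and the descent (part 3) are the sequels.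

* `halfExp`, `oddSet`, `two_mul_halfExp_add`, `sqrt_zpow_eq`, **`exp_Lsum_half`**;
* `rHalf`, `halfClassVec`, `archTermΦ_half_split`, **`archΦ_half_ev`** (`archΦ R v B pv τ (s/2) = ev α (halfClassVec R v B pv τ s)`)
  — the square-class SPLIT of seat p5's `ArchG3HalfPoint.archΦ_half` (`= Σ pᵢ·(…)·√(∏ αⱼ^{vᵢⱼ s})`);
* `oddSet_eq_of_congr` (exponents congruent mod `2` have the same parity class at odd `s`), `halfExp_add_two_mul`.

WHAT THIS IS NOT: no separation, no descent, no record; no crux moves.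

## References
* Yu. V. Nesterenko, LNM 1819 (2003) — §4.3 (4.36)–(4.45), p. 90–92. [Nesterenko2003]
* P. L. Cijsouw, M. Waldschmidt, Compositio Math. 34 (1977) — §4 (p. 189) (the tree's `CW77.Setup.Φ_half`, the model). [CijsouwWaldschmidt1977]
* M. Waldschmidt, Acta Arith. 37 (1980) — Lemma 3.7. [Waldschmidt1980]
-/

noncomputable section

open Finset Polynomial
open Literature.NumberTheory.Transcendental
open Literature.NumberTheory.Transcendental.CW77 (mono ev)
open Literature.NumberTheory.Transcendental.CW77.Setup (Tau tauNorm)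
open scoped Nat

namespace Summit.ABC.StewartYu

namespace ArchG3Setup

variable (S : ArchG3Setup) {ι : Type*} (R : ι → ℚ[X]) (v : ι → Fin S.n → ℤ)

/-! ### Parities and half exponents at a point `s` -/

/-- The integer part of the half exponent: `halfExp w s j = ⌊wⱼ s / 2⌋`. [cite: Nesterenko2003, §4.3 (4.42); shape only] -/
def halfExp (w : Fin S.n → ℤ) (s : ℤ) (j : Fin S.n) : ℤ := (w j * s) / 2

/-- The parity class at `s`: the generators with an odd exponent `wⱼ s`. [cite: CijsouwWaldschmidt1977, §4 (p. 189); shape only] -/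
def oddSet (w : Fin S.n → ℤ) (s : ℤ) : Finset (Fin S.n) := univ.filter fun j => (w j * s) % 2 = 1

/-- `wⱼ s = 2·halfExp + (1 if j ∈ oddSet else 0)`. [folklore] -/
theorem two_mul_halfExp_add (w : Fin S.n → ℤ) (s : ℤ) (j : Fin S.n) :
    2 * S.halfExp w s j + (if j ∈ S.oddSet w s then 1 else 0) = w j * s := by
  unfold halfExp oddSet
  have h := Int.mul_ediv_add_emod (w j * s) 2
  have hr : (w j * s) % 2 = 0 ∨ (w j * s) % 2 = 1 := Int.emod_two_eq_zero_or_one _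
  simp only [mem_filter, mem_univ, true_and]
  rcases hr with hr | hr
  · rw [if_neg (by omega)]; omega
  · rw [if_pos hr]; omega

/-- The rational part of `exp(Lsum w · s/2)`: `qEhZ w s = ∏ⱼ αⱼ^{⌊wⱼ s/2⌋}`. [cite: CijsouwWaldschmidt1977, §4 (p. 189); shape only] -/
def qEhZ (w : Fin S.n → ℤ) (s : ℤ) : ℚ := ∏ j, S.α j ^ S.halfExp w s j

/-- `qEhZ w s ≠ 0`. [folklore] -/
theorem qEhZ_ne (w : Fin S.n → ℤ) (s : ℤ) : S.qEhZ w s ≠ 0 :=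
  prod_ne_zero_iff.mpr fun j _ => zpow_ne_zero _ (S.α_ne j)

/-- `0 < qEhZ w s`. [folklore] -/
theorem qEhZ_pos (w : Fin S.n → ℤ) (s : ℤ) : 0 < S.qEhZ w s :=
  prod_pos fun j _ => zpow_pos (S.α_pos j) _

/-- `(√a)^e = a^{⌊e/2⌋} · (√a)^{e mod 2}` for `a > 0` and an INTEGER `e`. [folklore] -/
theorem sqrt_zpow_eq {a : ℝ} (ha : 0 < a) (e : ℤ) :
    Real.sqrt a ^ e = a ^ (e / 2) * (if e % 2 = 1 then Real.sqrt a else 1) := by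
  have hs : Real.sqrt a ≠ 0 := (Real.sqrt_pos.mpr ha).ne'
  have hsq : Real.sqrt a ^ (2 : ℤ) = a := by
    rw [show (2 : ℤ) = ((2 : ℕ) : ℤ) from rfl, zpow_natCast, Real.sq_sqrt ha.le]
  conv_lhs => rw [← Int.mul_ediv_add_emod e 2]
  rw [zpow_add₀ hs, zpow_mul, hsq]
  rcases Int.emod_two_eq_zero_or_one e with h | h
  · rw [h, if_neg (by omega), zpow_zero, mul_one]
  · rw [h, if_pos rfl, zpow_one]

/-- **`exp(Lsum w · s/2) = qEhZ w s · ∏_{j ∈ oddSet w s} √αⱼ`.** [cite: Nesterenko2003, §4.3 (4.42), p. 91] [cite: CijsouwWaldschmidt1977, §4 (p. 189)] -/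
theorem exp_Lsum_half (w : Fin S.n → ℤ) (s : ℤ) :
    Real.exp (S.Lsum w * ((s : ℝ) / 2)) = (S.qEhZ w s : ℝ) * mono S.α (S.oddSet w s) := by
  unfold Lsum
  rw [sum_mul, Real.exp_sum]
  have hterm : ∀ j, Real.exp ((w j : ℝ) * S.lg j * ((s : ℝ) / 2)) = Real.sqrt (S.α j : ℝ) ^ (w j * s) := by
    intro j
    have hpos : (0 : ℝ) < (S.α j : ℝ) := S.α_pos' j
    have e1 : (w j : ℝ) * S.lg j * ((s : ℝ) / 2) = (Real.log (S.α j : ℝ) * (1 / 2)) * ((w j * s : ℤ) : ℝ) := by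
      unfold lg; push_cast; ring
    rw [e1, Real.exp_mul, ← Real.rpow_def_of_pos hpos, ← Real.sqrt_eq_rpow, Real.rpow_intCast]
  simp_rw [hterm]
  have hsplit : ∀ j, Real.sqrt (S.α j : ℝ) ^ (w j * s) =
      ((S.α j : ℝ)) ^ S.halfExp w s j * (if j ∈ S.oddSet w s then Real.sqrt (S.α j : ℝ) else 1) := by
    intro j
    rw [sqrt_zpow_eq (S.α_pos' j)]
    unfold halfExp oddSet
    simp only [mem_filter, mem_univ, true_and]
  rw [prod_congr rfl (fun j _ => hsplit j), prod_mul_distrib]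
  unfold qEhZ mono
  push_cast
  congr 1
  rw [Finset.prod_ite_mem, Finset.univ_inter]

/-! ### The values at the half points -/

/-- The rational coefficient of one unknown at `s/2`: `(Hasse_{t₀}Rᵢ)(s/2) · zγpow(vᵢ, t) · qEhZ(vᵢ) s`.
[cite: CijsouwWaldschmidt1977, §4 (p. 189); shape only] -/
def rHalf (i : ι) (τ : Tau S.n) (s : ℤ) : ℚ :=
  (hasseDeriv τ.1 (R i)).eval ((s : ℚ) / 2) * S.zγpow v i τ.2 * S.qEhZ (v i) s

/-- **The class sums**: the rational coefficient of `∏_{j∈T} √αⱼ` in `φ_τ(s/2)`,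
`halfClassVec T = Σ_{i ∈ B, oddSet(vᵢ) s = T} pᵢ · rHalf i τ s`. [cite: CijsouwWaldschmidt1977, §4 (p. 189); shape only]
[cite: Nesterenko2003, §4.3 (4.43), p. 91; shape only] -/
def halfClassVec (B : Finset ι) (pv : ι → ℤ) (τ : Tau S.n) (s : ℤ) (T : Finset (Fin S.n)) : ℚ :=
  ∑ i ∈ B with S.oddSet (v i) s = T, (pv i : ℚ) * S.rHalf R v i τ s

/-- **One term of `φ_τ` at `s/2`**: `archTermΦ i τ (s/2) = rHalf i τ s · ∏_{j ∈ oddSet(vᵢ) s} √αⱼ`. [cite: CijsouwWaldschmidt1977, §4 (p. 189)] -/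
theorem archTermΦ_half_split (i : ι) (τ : Tau S.n) (s : ℤ) :
    S.archTermΦ R v i τ ((s : ℂ) / 2) = (((S.rHalf R v i τ s : ℝ) * mono S.α (S.oddSet (v i) s) : ℝ) : ℂ) := by
  unfold archTermΦ rHalf
  have hpt : ((s : ℂ) / 2) = (((s : ℚ) / 2 : ℚ) : ℂ) := by push_cast; ring
  have hexp : Complex.exp (S.Lc (v i) * ((s : ℂ) / 2)) = ((Real.exp (S.Lsum (v i) * ((s : ℝ) / 2)) : ℝ) : ℂ) := by
    unfold Lc; push_cast; ring_nf
  rw [hexp, S.exp_Lsum_half, hpt, hw_eval_ratCast]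
  push_cast
  ring

/-- **`φ_τ(s/2) = ev α (halfClassVec)`** — the value at a half point expressed on the basis `{∏_{j∈T} √αⱼ}_T` of `ℚ(√α₁,…,√αₙ)`
with rational coefficients (the class sums). [cite: Nesterenko2003, §4.3 (4.42)–(4.43), p. 91] [cite: CijsouwWaldschmidt1977, §4 (p. 189)] -/
theorem archΦ_half_ev (B : Finset ι) (pv : ι → ℤ) (τ : Tau S.n) (s : ℤ) :
    S.archΦ R v B pv τ ((s : ℂ) / 2) = ((ev S.α (S.halfClassVec R v B pv τ s) : ℝ) : ℂ) := by
  classical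
  unfold archΦ ev halfClassVec
  have hfib : ∑ i ∈ B, (pv i : ℂ) * S.archTermΦ R v i τ ((s : ℂ) / 2) =
      ((∑ i ∈ B, ((pv i : ℚ) * S.rHalf R v i τ s : ℝ) * mono S.α (S.oddSet (v i) s) : ℝ) : ℂ) := by
    push_cast
    refine sum_congr rfl fun i _ => ?_
    rw [S.archTermΦ_half_split R v]; push_cast; ring
  rw [hfib]
  congr 1
  rw [← Finset.sum_fiberwise B (fun i => S.oddSet (v i) s)
    (fun i => ((pv i : ℚ) * S.rHalf R v i τ s : ℝ) * mono S.α (S.oddSet (v i) s))]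
  refine sum_congr rfl fun T _ => ?_
  rw [Rat.cast_sum, sum_mul]
  refine sum_congr rfl fun i hi => ?_
  rw [(Finset.mem_filter.mp hi).2]; push_cast; ring

/-- The real absolute value of `φ_τ(s/2)` is `|ev α (halfClassVec)|`. [folklore] -/
theorem norm_archΦ_half_ev (B : Finset ι) (pv : ι → ℤ) (τ : Tau S.n) (s : ℤ) :
    ‖S.archΦ R v B pv τ ((s : ℂ) / 2)‖ = |ev S.α (S.halfClassVec R v B pv τ s)| := by
  rw [S.archΦ_half_ev, Complex.norm_real, Real.norm_eq_abs]

/-! ### Parity classes and congruent exponents -/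

/-- Exponent vectors congruent modulo `2` have the same parity class (at every `s`). [folklore] -/
theorem oddSet_eq_of_congr {w w' : Fin S.n → ℤ} (h : ∀ j, 2 ∣ w j - w' j) (s : ℤ) : S.oddSet w s = S.oddSet w' s := by
  unfold oddSet
  refine filter_congr fun j _ => ?_
  obtain ⟨d, hd⟩ := h j
  have e1 : w j * s = w' j * s + 2 * (d * s) := by
    have : w j = w' j + 2 * d := by omega
    rw [this]; ring
  rw [e1, Int.add_mul_emod_self_left]

/-- At an ODD `s`, the same parity class forces congruent exponents. [folklore] -/
theorem congr_of_oddSet_eq {w w' : Fin S.n → ℤ} {s : ℤ} (hs : Odd s) (h : S.oddSet w s = S.oddSet w' s) :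
    ∀ j, 2 ∣ w j - w' j := by
  intro j
  have hj := congrArg (fun T : Finset (Fin S.n) => j ∈ T) h
  simp only [oddSet, mem_filter, mem_univ, true_and, eq_iff_iff] at hj
  obtain ⟨m, hm⟩ := hs
  have h1 : (w j * s) % 2 = (w j) % 2 := by
    rw [hm, show w j * (2 * m + 1) = w j + 2 * (w j * m) by ring, Int.add_mul_emod_self_left]
  have h2 : (w' j * s) % 2 = (w' j) % 2 := by
    rw [hm, show w' j * (2 * m + 1) = w' j + 2 * (w' j * m) by ring, Int.add_mul_emod_self_left]
  rw [h1, h2] at hj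
  have := Int.emod_two_eq_zero_or_one (w j)
  have := Int.emod_two_eq_zero_or_one (w' j)
  have : (w j - w' j) % 2 = 0 := by omega
  exact Int.dvd_of_emod_eq_zero this

/-- Shifting an exponent vector by `2w′` shifts the half exponents by `w′ s` (at every `s`). [folklore] -/
theorem halfExp_add_two_mul (w₀ w' : Fin S.n → ℤ) (s : ℤ) (j : Fin S.n) :
    S.halfExp (w₀ + (2 : ℤ) • w') s j = S.halfExp w₀ s j + w' j * s := by
  unfold halfExp
  simp only [Pi.add_apply, Pi.smul_apply, smul_eq_mul]
  rw [show (w₀ j + 2 * w' j) * s = w₀ j * s + 2 * (w' j * s) by ring, Int.add_mul_ediv_left _ _ two_ne_zero]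

/-- **The rational part factors along a class**: `qEhZ (w₀ + 2w′) s = qEhZ w₀ s · ∏ⱼ αⱼ^{w′ⱼ s}` — a monomial of the RE-BASED family
times a common non-zero factor. [cite: Nesterenko2003, §4.3 (4.46)–(4.48), p. 93; shape only] -/
theorem qEhZ_add_two_mul (w₀ w' : Fin S.n → ℤ) (s : ℤ) :
    S.qEhZ (w₀ + (2 : ℤ) • w') s = S.qEhZ w₀ s * ∏ j, S.α j ^ (w' j * s) := by
  unfold qEhZ
  rw [← prod_mul_distrib]
  refine prod_congr rfl fun j _ => ?_
  rw [S.halfExp_add_two_mul, zpow_add₀ (S.α_ne j)]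

end ArchG3Setup

end Summit.ABC.StewartYu

end
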